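import Literature.MathematicalPhysics.QuantumLattice.QuasiAdiabaticWeight
import Literature.MathematicalPhysics.QuantumLattice.FermionLiebRobinson
import Literature.MathematicalPhysics.QuantumLattice.LiebRobinsonHastingsKomaSpectralProofs
import HarnessLib

/-!
# The quasi-adiabatic generator `𝓘_γ^H(A) = ∫ W_γ(t) e^{itH} A e^{-itH} dt` on matrices

Bachmann–Michalakis–Nachtergaele–Sims, Comm. Math. Phys. **309** (2012) 835–871 (BMNS), §2 and
§4: the map `A ↦ 𝓘(A) = ∫ W_γ(t) τ_t^H(A) dt` with the weight `W_γ` of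
`Literature/MathematicalPhysics/QuantumLattice/QuasiAdiabaticWeight.lean` (BMNS Corollary 2.8:
the generator of the spectral flow is `D(s) = 𝓘^{H(s)}(H'(s))`). It is the map `𝓘` of
Bachmann–De Roeck–Fraas, CMP **361** (2018) §4 and of Bachmann–Bols–De Roeck–Fraas, CMP **375**
(2019) Prop. 2.4 (`K̃_± = i𝓘(J_±)`, local charge fluctuations of a gapped ground state), and
Hastings' quasi-adiabatic continuation operator (Phys. Rev. B **69** (2004) 104431, §II;
Hastings–Wen Phys. Rev. B **72** (2005) 045141). Everything here is for finite matrices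
(`Matrix n n ℂ` with the `L²`-operator norm) and PROVED (no named facts):

* `qaGenerator γ H A` (definition, a Bochner integral); `norm_qaGenerator_le`:
  `‖𝓘(A)‖ ≤ (‖W₁‖₁/γ)‖A‖`; `conjTranspose_qaGenerator`: `𝓘(A)ᴴ = 𝓘(Aᴴ)`, so `i𝓘(X)` is Hermitian
  for anti-Hermitian `X` (`isHermitian_I_smul_qaGenerator`, e.g. `X = [Q, H]`);
  `qaGenerator_mem_subalgebra`: `H, A ∈ S ⟹ 𝓘^H(A) ∈ S` for any subalgebra `S` (strict locality
  for a strictly local `H`; via `integral_mem_subalgebra`, `exp_mem_of_mem_subalgebra`).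
* **Exact intertwining across the gap** (`qaGenerator_intertwines`, BMNS Prop. 2.4 / BDF18
  Prop. 4.1 / the identity `[Q,P] - i[𝓘([Q,H]),P] = 0` in BBDF19 Prop. 2.4): if `H` is Hermitian
  with a unique ground state `ψ` and gap `g ≥ γ`, then for EVERY `A` the vector `ψ` is an exact
  eigenvector of `A - i𝓘_γ^H([A,H])`. Proof by matrix elements in the eigenbasis:
  `vᵢ⋆·τ_t(X)ψ = e^{it(λᵢ-E₀)} vᵢ⋆·Xψ`, `∫ W_γ(t)e^{itΔ}dt = i/Δ` (`integral_qaWeight_mul_cexp`)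
  and `vᵢ⋆·[A,H]ψ = -(λᵢ-E₀) vᵢ⋆·Aψ`.
* **Locality** (`norm_qaGenerator_sub_qaGenerator_le`, `…_of_commutator`; BMNS Lemma 4.7 in
  matrix form): `‖𝓘^H(A) - 𝓘^{H'}(A)‖ ≤ ε‖W₁‖₁/γ + 4‖A‖C_k γ⁻¹(1+γT)^{-(k+1)}` whenever the two
  dynamics agree on `A` up to `ε` for `|t| ≤ T`, which by the Duhamel bound
  `norm_heisenbergEvolution_sub_heisenbergEvolution_le` (`‖τ_t^H B - τ_t^{H'} B‖ ≤
  |∫₀^{-t}‖[τ_u^H(H-H'),B]‖|`) follows from a Lieb–Robinson bound on `[τ_u^H(H - H'), A]`.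

Deliberately NOT here: the `s`-dependent spectral flow `U(s)` and its ODE (the sibling files
`SpectralFlowWeightProofs.lean`, `LinearMatrixODEProofs.lean` of the Michalakis–Zwolak
formalisation treat that; `SpectralFlowWeightProofs.exists_spectralFlowWeight` is an existential
`ℂ`-valued weight with the same spectral identity), infinite systems, and any lattice structure.

## References

* S. Bachmann, S. Michalakis, B. Nachtergaele, R. Sims, Comm. Math. Phys. **309** (2012) 835–871,
  Proposition 2.4, Corollary 2.8, Lemma 4.7. [BachmannMichalakisNachtergaeleSimsCMP2012]
* S. Bachmann, A. Bols, W. De Roeck, M. Fraas, Comm. Math. Phys. **375** (2019) 1249, Prop. 2.4.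
  [BachmannEtAl2019]
* M. B. Hastings, Phys. Rev. B **69** (2004) 104431, §II. [HastingsPRB2004]
* M. B. Hastings, X.-G. Wen, Phys. Rev. B **72** (2005) 045141. [HastingsWen2005]
* The tree: `heisenbergEvolution`, `norm_heisenbergEvolution_holds`,
  `heisenbergEvolution_conjTranspose` (LocalDynamics); `hasDerivAt_interactionPicture`,
  `norm_interactionPicture_deriv` (LiebRobinsonIntegralProofs); `exists_ground_index`,
  `sum_dotProduct_smul_eigenvectorBasis`, `exp_smul_mulVec_of_mulVec_eq`
  (LiebRobinsonHastingsKomaSpectralProofs); Mathlib `ContinuousLinearMap.integral_comp_comm`,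
  `Subspace.dualAnnihilator_dualCoannihilator_eq`, `NormedSpace.exp_series_hasSum_exp'`.
-/

noncomputable section

open Real Complex Set Filter MeasureTheory
open scoped Topology ComplexConjugate

namespace Literature.MathematicalPhysics.QuantumLattice

open Matrix
open scoped Matrix.Norms.L2Operator

section Generator

variable {n : Type*} [Fintype n] [DecidableEq n]

/-! ### Subalgebra-valued exponentials and integrals -/

/-- A subalgebra of the (finite-dimensional) matrix algebra is closed under the exponential.
[folklore] -/
theorem exp_mem_of_mem_subalgebra (S : Subalgebra ℂ (Matrix n n ℂ)) {X : Matrix n n ℂ}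
    (hX : X ∈ S) : NormedSpace.exp X ∈ S := by
  have hclosed : IsClosed ((Subalgebra.toSubmodule S : Submodule ℂ _) : Set (Matrix n n ℂ)) :=
    Submodule.closed_of_finiteDimensional _
  have hsum := (NormedSpace.exp_series_hasSum_exp' (𝕂 := ℂ) X).tendsto_sum_nat
  refine hclosed.mem_of_tendsto hsum (Filter.Eventually.of_forall fun m => ?_)
  exact Submodule.sum_mem _ fun k _ => Submodule.smul_mem _ _ (Subalgebra.pow_mem S hX k)

/-- The Heisenberg evolution stays in any subalgebra containing `H` and `A`. [folklore] -/
theorem heisenbergEvolution_mem_subalgebra (S : Subalgebra ℂ (Matrix n n ℂ)) {H A : Matrix n n ℂ}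
    (hH : H ∈ S) (hA : A ∈ S) (t : ℝ) : heisenbergEvolution H t A ∈ S := by
  unfold heisenbergEvolution
  exact S.mul_mem (S.mul_mem (exp_mem_of_mem_subalgebra S (S.smul_mem hH _)) hA)
    (exp_mem_of_mem_subalgebra S (S.smul_mem hH _))

/-- **Integrals of subalgebra-valued functions lie in the subalgebra** (finite dimension: a
subspace is the joint kernel of the functionals annihilating it, and continuous linear functionals
commute with the Bochner integral). [folklore] -/
theorem integral_mem_subalgebra (S : Subalgebra ℂ (Matrix n n ℂ)) {f : ℝ → Matrix n n ℂ}
    (hf : Integrable f) (hmem : ∀ t, f t ∈ S) : ∫ t, f t ∈ S := by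
  have key : ∀ φ : Module.Dual ℂ (Matrix n n ℂ), (∀ x ∈ Subalgebra.toSubmodule S, φ x = 0) →
      φ (∫ t, f t) = 0 := by
    intro φ hφ
    let L : Matrix n n ℂ →L[ℂ] ℂ := LinearMap.toContinuousLinearMap φ
    have h1 : L (∫ t, f t) = ∫ t, L (f t) := (L.integral_comp_comm hf).symm
    have h2 : (fun t => L (f t)) = fun _ => 0 := funext fun t => hφ _ (hmem t)
    show L (∫ t, f t) = 0
    rw [h1, h2, integral_zero]
  have hS : (Subalgebra.toSubmodule S).dualAnnihilator.dualCoannihilator = Subalgebra.toSubmodule S :=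
    Subspace.dualAnnihilator_dualCoannihilator_eq
  rw [← Subalgebra.mem_toSubmodule, ← hS, Submodule.mem_dualCoannihilator]
  intro φ hφ
  exact key φ ((Submodule.mem_dualAnnihilator φ).1 hφ)

/-! ### The generator `𝓘_γ^H(A) = ∫ W_γ(t) τ_t^H(A) dt` -/

/-- **The quasi-adiabatic generator map** `𝓘_γ^H(A) = ∫ W_γ(t) e^{itH} A e^{-itH} dt`
(BMNS 2012, Corollary 2.8 with `H' ↦ A`; the map `𝓘` of Bachmann–De Roeck–Fraas 2018 §4 and of
BBDF 2019, Prop. 2.4). [cite: BachmannMichalakisNachtergaeleSimsCMP2012, Corollary 2.8] -/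
def qaGenerator (γ : ℝ) (H A : Matrix n n ℂ) : Matrix n n ℂ :=
  ∫ t, (qaWeight γ t : ℂ) • heisenbergEvolution H t A

/-- The integrand of the generator is integrable (`W_γ ∈ L¹`, `‖τ_t(A)‖ = ‖A‖`). [folklore] -/
theorem integrable_qaWeight_smul_heisenbergEvolution {H : Matrix n n ℂ} (hH : H.IsHermitian)
    {γ : ℝ} (hγ : γ ≠ 0) (A : Matrix n n ℂ) :
    Integrable fun t : ℝ => (qaWeight γ t : ℂ) • heisenbergEvolution H t A := by
  refine ((integrable_qaWeight hγ).ofReal (𝕜 := ℂ)).smul_bdd (‖A‖)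
    (heisenbergEvolution_continuous H A).aestronglyMeasurable
    (Filter.Eventually.of_forall fun t => ?_)
  rw [norm_heisenbergEvolution_holds hH t A]

/-- At `γ = 0` the weight vanishes identically and so does the generator (junk case). [folklore] -/
theorem qaGenerator_zero_left (H A : Matrix n n ℂ) : qaGenerator 0 H A = 0 := by
  simp [qaGenerator, qaWeight, qaWeightOne_zero]

/-- **Norm bound** `‖𝓘_γ^H(A)‖ ≤ (‖W₁‖₁/γ) ‖A‖` (BMNS Lemma 2.6 (iii)). [folklore] -/
theorem norm_qaGenerator_le {H : Matrix n n ℂ} (hH : H.IsHermitian) {γ : ℝ} (hγ : 0 < γ)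
    (A : Matrix n n ℂ) : ‖qaGenerator γ H A‖ ≤ qaWeightL1 / γ * ‖A‖ := by
  unfold qaGenerator
  calc ‖∫ t, (qaWeight γ t : ℂ) • heisenbergEvolution H t A‖
      ≤ ∫ t, ‖(qaWeight γ t : ℂ) • heisenbergEvolution H t A‖ := norm_integral_le_integral_norm _
    _ = ∫ t, |qaWeight γ t| * ‖A‖ := by
        refine congrArg (fun F : ℝ → ℝ => ∫ t, F t) (funext fun t => ?_)
        rw [norm_smul, Complex.norm_real, Real.norm_eq_abs, norm_heisenbergEvolution_holds hH t A]
    _ = (∫ t, |qaWeight γ t|) * ‖A‖ := integral_mul_const _ _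
    _ = qaWeightL1 / γ * ‖A‖ := by rw [integral_abs_qaWeight hγ]

/-- The conjugate transpose as a continuous real-linear map on matrices. [folklore] -/
def conjTransposeRealCLM : Matrix n n ℂ →L[ℝ] Matrix n n ℂ :=
  LinearMap.toContinuousLinearMap
    { toFun := fun M => Mᴴ
      map_add' := fun M N => conjTranspose_add M N
      map_smul' := fun r M => by
        rw [conjTranspose_smul, RingHom.id_apply, star_trivial] }

omit [DecidableEq n] in
/-- Values of `conjTransposeRealCLM`. [folklore] -/
@[simp] theorem conjTransposeRealCLM_apply (M : Matrix n n ℂ) : conjTransposeRealCLM M = Mᴴ := rfl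

/-- **The generator is a `⋆`-map**: `𝓘(A)ᴴ = 𝓘(Aᴴ)` (the weight is real, `τ_t` is a `⋆`-map).
In particular `i 𝓘([Q,H])` is Hermitian for Hermitian `Q`, `H`. [folklore] -/
theorem conjTranspose_qaGenerator {H : Matrix n n ℂ} (hH : H.IsHermitian) (γ : ℝ)
    (A : Matrix n n ℂ) : (qaGenerator γ H A)ᴴ = qaGenerator γ H Aᴴ := by
  by_cases hγ : γ = 0
  · subst hγ; simp [qaGenerator_zero_left]
  unfold qaGenerator
  have hint := integrable_qaWeight_smul_heisenbergEvolution hH hγ A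
  have h := (conjTransposeRealCLM (n := n)).integral_comp_comm hint
  simp only [conjTransposeRealCLM_apply] at h
  rw [← h]
  refine congrArg (fun F : ℝ → Matrix n n ℂ => ∫ t, F t) (funext fun t => ?_)
  rw [conjTranspose_smul, heisenbergEvolution_conjTranspose hH, Complex.star_def, Complex.conj_ofReal]

/-- The generator is additive-inverse compatible: `𝓘(-X) = -𝓘(X)`. [folklore] -/
theorem qaGenerator_neg (γ : ℝ) (H X : Matrix n n ℂ) : qaGenerator γ H (-X) = -qaGenerator γ H X := by
  simp only [qaGenerator, heisenbergEvolution, Matrix.mul_neg, Matrix.neg_mul, smul_neg, integral_neg]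

/-- **`i 𝓘_γ^H(X)` is Hermitian for anti-Hermitian `X`** (e.g. `X = [Q, H]`, or a boundary
current `J_±`). [folklore] -/
theorem isHermitian_I_smul_qaGenerator {H X : Matrix n n ℂ} (hH : H.IsHermitian)
    (hX : Xᴴ = -X) (γ : ℝ) : (I • qaGenerator γ H X).IsHermitian := by
  unfold Matrix.IsHermitian
  rw [conjTranspose_smul, conjTranspose_qaGenerator hH, hX, qaGenerator_neg, Complex.star_def,
    Complex.conj_I, neg_smul_neg]

/-- **`i 𝓘_γ^H([Q,H])` is Hermitian** for Hermitian `Q`, `H`. [folklore] -/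
theorem isHermitian_I_smul_qaGenerator_commutator {H Q : Matrix n n ℂ} (hH : H.IsHermitian)
    (hQ : Q.IsHermitian) (γ : ℝ) : (I • qaGenerator γ H (Q * H - H * Q)).IsHermitian := by
  refine isHermitian_I_smul_qaGenerator hH ?_ γ
  rw [conjTranspose_sub, conjTranspose_mul, conjTranspose_mul, hH.eq, hQ.eq]
  abel

/-- **The generator preserves subalgebras**: if `H, A ∈ S` then `𝓘_γ^H(A) ∈ S` (strict locality of
`𝓘` for a strictly local Hamiltonian). [folklore] -/
theorem qaGenerator_mem_subalgebra (S : Subalgebra ℂ (Matrix n n ℂ)) {H A : Matrix n n ℂ}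
    (hH : H.IsHermitian) (hHS : H ∈ S) (hAS : A ∈ S) (γ : ℝ) : qaGenerator γ H A ∈ S := by
  by_cases hγ : γ = 0
  · subst hγ; rw [qaGenerator_zero_left]; exact S.zero_mem
  exact integral_mem_subalgebra S (integrable_qaWeight_smul_heisenbergEvolution hH hγ A)
    fun t => S.smul_mem (heisenbergEvolution_mem_subalgebra S hHS hAS t) _

/-! ### The exact intertwining across the gap -/

/-- The functional `M ↦ v⋆ · M ψ` as a continuous linear map. [folklore] -/
def matrixElementCLM (v ψ : n → ℂ) : Matrix n n ℂ →L[ℂ] ℂ :=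
  LinearMap.toContinuousLinearMap
    { toFun := fun M => star v ⬝ᵥ (M *ᵥ ψ)
      map_add' := fun M N => by simp only [add_mulVec, dotProduct_add]
      map_smul' := fun c M => by rw [smul_mulVec, dotProduct_smul, RingHom.id_apply] }

omit [DecidableEq n] in
/-- Values of `matrixElementCLM`. [folklore] -/
@[simp] theorem matrixElementCLM_apply (v ψ : n → ℂ) (M : Matrix n n ℂ) :
    matrixElementCLM v ψ M = star v ⬝ᵥ (M *ᵥ ψ) := rfl

/-- Matrix elements of a Hermitian matrix against an eigenvector on the left:
`vᵢ⋆ · H w = λᵢ (vᵢ⋆ · w)`. [folklore] -/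
theorem star_eigenvectorBasis_dotProduct_mulVec {H : Matrix n n ℂ} (hH : H.IsHermitian) (i : n)
    (w : n → ℂ) : star (⇑(hH.eigenvectorBasis i)) ⬝ᵥ (H *ᵥ w) =
      (hH.eigenvalues i : ℂ) * (star (⇑(hH.eigenvectorBasis i)) ⬝ᵥ w) := by
  have e : star (⇑(hH.eigenvectorBasis i)) ᵥ* H = (hH.eigenvalues i : ℂ) • star (⇑(hH.eigenvectorBasis i)) := by
    have h := star_mulVec H (⇑(hH.eigenvectorBasis i))
    rw [hH.eq] at h
    rw [← h, hH.mulVec_eigenvectorBasis i]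
    funext k
    simp only [Pi.star_apply, Pi.smul_apply, Complex.real_smul, star_mul', Complex.star_def,
      Complex.conj_ofReal, smul_eq_mul]
  rw [dotProduct_mulVec, e, smul_dotProduct, smul_eq_mul]

/-- **Matrix elements of the Heisenberg evolution between an eigenvector and a vector `ψ` with
`Hψ = E₀ψ`**: `vᵢ⋆ · τ_t(X) ψ = e^{it(λᵢ - E₀)} (vᵢ⋆ · X ψ)`. [folklore] -/
theorem star_eigenvectorBasis_dotProduct_heisenbergEvolution_mulVec {H : Matrix n n ℂ}
    (hH : H.IsHermitian) (i : n) {ψ : n → ℂ} {E₀ : ℝ} (hψ : H *ᵥ ψ = (E₀ : ℂ) • ψ)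
    (X : Matrix n n ℂ) (t : ℝ) :
    star (⇑(hH.eigenvectorBasis i)) ⬝ᵥ (heisenbergEvolution H t X *ᵥ ψ) =
      cexp (((t * (hH.eigenvalues i - E₀) : ℝ) : ℂ) * I) *
        (star (⇑(hH.eigenvectorBasis i)) ⬝ᵥ (X *ᵥ ψ)) := by
  set U := NormedSpace.exp ((I * (t : ℂ)) • H) with hU
  set V := NormedSpace.exp ((-(I * (t : ℂ))) • H) with hV
  have hVψ : V *ᵥ ψ = cexp (-(I * t) * E₀) • ψ := exp_smul_mulVec_of_mulVec_eq H hψ _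
  have hUH : Uᴴ = V := conjTranspose_exp_I_mul_smul hH t
  have hVv : V *ᵥ ⇑(hH.eigenvectorBasis i) = cexp (-(I * t) * hH.eigenvalues i) • ⇑(hH.eigenvectorBasis i) :=
    exp_smul_mulVec_eigenvectorBasis hH _ i
  have hτ : heisenbergEvolution H t X = U * X * V := rfl
  rw [hτ, ← mulVec_mulVec, ← mulVec_mulVec, hVψ, mulVec_smul, mulVec_smul, dotProduct_smul,
    dotProduct_mulVec, ← conjTranspose_conjTranspose U, ← star_mulVec, hUH, hVv, star_smul,
    smul_dotProduct]
  simp only [smul_eq_mul, Complex.star_def, ← Complex.exp_conj, map_mul, map_neg, Complex.conj_I,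
    Complex.conj_ofReal]
  rw [← mul_assoc, ← Complex.exp_add]
  congr 1
  push_cast
  ring_nf

/-- **Exact intertwining of the quasi-adiabatic generator across a spectral gap** (BMNS 2012
Prop. 2.4; Bachmann–De Roeck–Fraas CMP 361 (2018) Prop. 4.1; the identity
`[Q, P] - i[𝓘([Q,H]), P] = 0` of BBDF 2019, proof of Prop. 2.4). Let `H` be Hermitian with a unique
ground state and spectral gap `g ≥ γ > 0`, and `ψ` a normalised ground-state vector. Then for EVERY
matrix `A`, `ψ` is an exact eigenvector of `A - i 𝓘_γ^H([A, H])`: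
`(A - i𝓘([A,H])) ψ = ⟨ψ, (A - i𝓘([A,H])) ψ⟩ ψ`.
Proof: in the eigenbasis, `vᵢ⋆ · 𝓘(X)ψ = Ŵ_γ(λᵢ - E₀) (vᵢ⋆ · Xψ)` with `Ŵ_γ(Δ) = i/Δ` for `Δ ≥ γ`
(`integral_qaWeight_mul_cexp`), and `vᵢ⋆ · [A,H]ψ = -(λᵢ - E₀)(vᵢ⋆ · Aψ)`, so all components of
`(A - i𝓘([A,H]))ψ` off the ground state vanish.
[cite: BachmannMichalakisNachtergaeleSimsCMP2012, Proposition 2.4] -/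
theorem qaGenerator_intertwines {H : Matrix n n ℂ} (hH : H.IsHermitian) {γ g : ℝ} (hγ : 0 < γ)
    (hγg : γ ≤ g) (hgap : H.HasSpectralGap g) {ψ : n → ℂ} (hψ : H.IsGroundStateVector ψ)
    (hψ1 : star ψ ⬝ᵥ ψ = 1) (A : Matrix n n ℂ) :
    (A - I • qaGenerator γ H (A * H - H * A)) *ᵥ ψ =
      (star ψ ⬝ᵥ ((A - I • qaGenerator γ H (A * H - H * A)) *ᵥ ψ)) • ψ := by
  obtain ⟨i₀, c, hev0, hothers, hψc, hc⟩ := exists_ground_index hH hgap hψ hψ1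
  have hψeq : H *ᵥ ψ = (H.groundEnergy : ℂ) • ψ := hψ.2
  set M := A - I • qaGenerator γ H (A * H - H * A) with hM
  -- Step 1: the components off the ground state vanish
  have hcomp : ∀ i, i ≠ i₀ → star (⇑(hH.eigenvectorBasis i)) ⬝ᵥ (M *ᵥ ψ) = 0 := by
    intro i hi
    have hΔγ : γ ≤ hH.eigenvalues i - H.groundEnergy := by have := hothers i hi; linarith
    have hΔ0 : ((hH.eigenvalues i - H.groundEnergy : ℝ) : ℂ) ≠ 0 := by
      exact_mod_cast (hγ.trans_le hΔγ).ne'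
    -- `vᵢ⋆ · [A,H] ψ = -Δ a`
    have hX : star (⇑(hH.eigenvectorBasis i)) ⬝ᵥ ((A * H - H * A) *ᵥ ψ) =
        -((hH.eigenvalues i - H.groundEnergy : ℝ) : ℂ) *
          (star (⇑(hH.eigenvectorBasis i)) ⬝ᵥ (A *ᵥ ψ)) := by
      rw [sub_mulVec, ← mulVec_mulVec, ← mulVec_mulVec, hψeq, mulVec_smul, dotProduct_sub,
        dotProduct_smul, star_eigenvectorBasis_dotProduct_mulVec hH i, smul_eq_mul]
      push_cast
      ring
    -- `vᵢ⋆ · 𝓘([A,H]) ψ = (i/Δ) (-Δ a) = -i a`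
    have hint := integrable_qaWeight_smul_heisenbergEvolution hH hγ.ne' (A * H - H * A)
    have hgen : star (⇑(hH.eigenvectorBasis i)) ⬝ᵥ (qaGenerator γ H (A * H - H * A) *ᵥ ψ) =
        -I * (star (⇑(hH.eigenvectorBasis i)) ⬝ᵥ (A *ᵥ ψ)) := by
      have h1 := (matrixElementCLM (⇑(hH.eigenvectorBasis i)) ψ).integral_comp_comm hint
      simp only [matrixElementCLM_apply] at h1
      rw [qaGenerator, ← h1]
      have e : ∀ t : ℝ, star (⇑(hH.eigenvectorBasis i)) ⬝ᵥ
          (((qaWeight γ t : ℂ) • heisenbergEvolution H t (A * H - H * A)) *ᵥ ψ) =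
          ((qaWeight γ t : ℂ) * cexp (((t * (hH.eigenvalues i - H.groundEnergy) : ℝ) : ℂ) * I)) *
            (-((hH.eigenvalues i - H.groundEnergy : ℝ) : ℂ) *
              (star (⇑(hH.eigenvectorBasis i)) ⬝ᵥ (A *ᵥ ψ))) := by
        intro t
        rw [smul_mulVec, dotProduct_smul,
          star_eigenvectorBasis_dotProduct_heisenbergEvolution_mulVec hH i hψeq, hX, smul_eq_mul]
        ring
      simp_rw [e]
      rw [integral_mul_const, integral_qaWeight_mul_cexp hγ (hΔγ.trans (le_abs_self _)),
        div_mul_eq_mul_div, div_eq_iff hΔ0]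
      ring
    rw [hM, sub_mulVec, dotProduct_sub, smul_mulVec, dotProduct_smul, hgen, smul_eq_mul]
    have hI : I * (-I * (star (⇑(hH.eigenvectorBasis i)) ⬝ᵥ (A *ᵥ ψ))) =
        star (⇑(hH.eigenvectorBasis i)) ⬝ᵥ (A *ᵥ ψ) := by
      rw [← mul_assoc, mul_neg, Complex.I_mul_I, neg_neg, one_mul]
    rw [hI, sub_self]
  -- Step 2: expand `M ψ` in the eigenbasis
  have hexp := sum_dotProduct_smul_eigenvectorBasis hH (M *ᵥ ψ)
  rw [← Finset.add_sum_erase _ _ (Finset.mem_univ i₀)] at hexp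
  have hrest : ∑ i ∈ Finset.univ.erase i₀,
      (star (⇑(hH.eigenvectorBasis i)) ⬝ᵥ (M *ᵥ ψ)) • ⇑(hH.eigenvectorBasis i) = 0 :=
    Finset.sum_eq_zero fun i hi => by rw [hcomp i (Finset.ne_of_mem_erase hi), zero_smul]
  rw [hrest, add_zero] at hexp
  -- `v_{i₀} = conj(c) ψ` and `ψ⋆ = conj(c) v_{i₀}⋆`
  have hv₀ : ⇑(hH.eigenvectorBasis i₀) = starRingEnd ℂ c • ψ := by
    rw [hψc, smul_smul, hc, one_smul]
  have hstarψ : star ψ = starRingEnd ℂ c • star (⇑(hH.eigenvectorBasis i₀)) := by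
    rw [hψc, star_smul]
    rfl
  calc M *ᵥ ψ = (star (⇑(hH.eigenvectorBasis i₀)) ⬝ᵥ (M *ᵥ ψ)) • ⇑(hH.eigenvectorBasis i₀) :=
        hexp.symm
    _ = ((star (⇑(hH.eigenvectorBasis i₀)) ⬝ᵥ (M *ᵥ ψ)) * starRingEnd ℂ c) • ψ := by
        rw [hv₀, smul_smul]
    _ = (star ψ ⬝ᵥ (M *ᵥ ψ)) • ψ := by
        rw [hstarψ, smul_dotProduct, smul_eq_mul, mul_comm]


/-! ### Comparison of two dynamics and locality of the generator -/

/-- **Duhamel bound for the difference of two Heisenberg dynamics** (interaction picture, as in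
the tree's `norm_comm_heisenbergEvolution_le`): for Hermitian `H`, `H'` and every `B`, `t`,
`‖τ_t^H(B) - τ_t^{H'}(B)‖ ≤ |∫₀^{-t} ‖[τ_u^H(H - H'), B]‖ du|`. [folklore] -/
theorem norm_heisenbergEvolution_sub_heisenbergEvolution_le {H H' : Matrix n n ℂ}
    (hH : H.IsHermitian) (hH' : H'.IsHermitian) (B : Matrix n n ℂ) (t : ℝ) :
    ‖heisenbergEvolution H t B - heisenbergEvolution H' t B‖ ≤
      |∫ u in (0 : ℝ)..(-t),
        ‖heisenbergEvolution H u (H - H') * B - B * heisenbergEvolution H u (H - H')‖| := by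
  set G : ℝ → Matrix n n ℂ := fun u => NormedSpace.exp (u • (I • H')) * heisenbergEvolution H (-u) B *
    NormedSpace.exp (u • (-(I • H'))) with hG
  set G' : ℝ → Matrix n n ℂ := fun u => -(NormedSpace.exp (u • (I • H')) *
    ((I • H - I • H') * heisenbergEvolution H (-u) B -
      heisenbergEvolution H (-u) B * (I • H - I • H')) * NormedSpace.exp (u • (-(I • H')))) with hG'
  have hderiv : ∀ u, HasDerivAt G (G' u) u := fun u => hasDerivAt_interactionPicture H H' B u
  have hcont : Continuous G' := continuous_interactionPicture_deriv H H' B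
  have hFTC : ∫ u in (0 : ℝ)..(-t), G' u = G (-t) - G 0 :=
    intervalIntegral.integral_eq_sub_of_hasDerivAt (fun u _ => hderiv u) (hcont.intervalIntegrable _ _)
  have hG0 : G 0 = B := by simp [hG]
  have hGt : G (-t) = heisenbergEvolution H' (-t) (heisenbergEvolution H t B) := by
    simp only [hG, neg_neg, heisenbergEvolution_eq_exp_smul H' (-t)]
  -- `‖G(-t) - B‖ = ‖τ_t^H B - τ_t^{H'} B‖`
  have hnorm : ‖G (-t) - G 0‖ = ‖heisenbergEvolution H t B - heisenbergEvolution H' t B‖ := by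
    rw [hGt, hG0]
    have e : heisenbergEvolution H' (-t) (heisenbergEvolution H t B) - B =
        heisenbergEvolution H' (-t) (heisenbergEvolution H t B - heisenbergEvolution H' t B) := by
      rw [heisenbergEvolution_sub, ← heisenbergEvolution_add, neg_add_cancel, heisenbergEvolution_zero]
    rw [e, norm_heisenbergEvolution_holds hH']
  rw [← hnorm, ← hFTC]
  refine intervalIntegral.norm_integral_le_abs_integral_norm.trans (le_of_eq ?_)
  congr 1
  refine intervalIntegral.integral_congr fun u _ => ?_
  exact norm_interactionPicture_deriv hH hH' B u

/-- Points of `Ι 0 s` have absolute value at most `|s|`. [folklore] -/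
theorem abs_le_of_mem_uIoc_zero {s u : ℝ} (hu : u ∈ Set.uIoc 0 s) : |u| ≤ |s| := by
  rcases Set.mem_uIoc.1 hu with ⟨h1, h2⟩ | ⟨h1, h2⟩
  · rw [abs_of_pos h1]; exact h2.trans (le_abs_self s)
  · rw [abs_of_nonpos h2]; exact (neg_le_neg h1.le).trans (neg_le_abs s)

/-- **Uniform form of the Duhamel bound**: if `‖[τ_u^H(H - H'), B]‖ ≤ η` for all `|u| ≤ |t|` then
`‖τ_t^H(B) - τ_t^{H'}(B)‖ ≤ η |t|`. [folklore] -/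
theorem norm_heisenbergEvolution_sub_heisenbergEvolution_le_of_le {H H' : Matrix n n ℂ}
    (hH : H.IsHermitian) (hH' : H'.IsHermitian) (B : Matrix n n ℂ) {t η : ℝ}
    (hη : ∀ u : ℝ, |u| ≤ |t| →
      ‖heisenbergEvolution H u (H - H') * B - B * heisenbergEvolution H u (H - H')‖ ≤ η) :
    ‖heisenbergEvolution H t B - heisenbergEvolution H' t B‖ ≤ η * |t| := by
  refine (norm_heisenbergEvolution_sub_heisenbergEvolution_le hH hH' B t).trans ?_
  have h := intervalIntegral.norm_integral_le_of_norm_le_const (a := (0:ℝ)) (b := -t) (C := η)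
    (f := fun u => ‖heisenbergEvolution H u (H - H') * B - B * heisenbergEvolution H u (H - H')‖)
    (fun u hu => by
      rw [Real.norm_eq_abs, abs_of_nonneg (norm_nonneg _)]
      exact hη u ((abs_le_of_mem_uIoc_zero hu).trans (by rw [abs_neg])))
  rw [Real.norm_eq_abs, sub_zero, abs_neg] at h
  exact h

/-- **Locality of the quasi-adiabatic generator** (BMNS 2012 Lemma 4.7 in matrix form): if the
dynamics of `H` and `H'` agree on `A` up to `ε` for times `|t| ≤ T`, then
`‖𝓘_γ^H(A) - 𝓘_γ^{H'}(A)‖ ≤ ε ‖W_γ‖₁ + 2‖A‖ ∫_{|t|>T} |W_γ| ≤ ε ‖W₁‖₁/γ + 4‖A‖ C_k γ⁻¹ (1+γT)^{-(k+1)}`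
for every `k`. In the application `H'` is the restriction of `H` to a neighbourhood of the support
of `A`, `𝓘^{H'}(A)` is strictly local (`qaGenerator_mem_subalgebra`) and `ε` comes from the
Lieb–Robinson bound via `norm_heisenbergEvolution_sub_heisenbergEvolution_le_of_le`.
[cite: BachmannMichalakisNachtergaeleSimsCMP2012, Lemma 4.7] -/
theorem norm_qaGenerator_sub_qaGenerator_le {H H' : Matrix n n ℂ} (hH : H.IsHermitian)
    (hH' : H'.IsHermitian) {γ : ℝ} (hγ : 0 < γ) (A : Matrix n n ℂ) {T ε : ℝ} (hT : 0 ≤ T)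
    (hε0 : 0 ≤ ε)
    (hε : ∀ t : ℝ, |t| ≤ T → ‖heisenbergEvolution H t A - heisenbergEvolution H' t A‖ ≤ ε)
    (k : ℕ) :
    ‖qaGenerator γ H A - qaGenerator γ H' A‖ ≤
      ε * (qaWeightL1 / γ) + 2 * ‖A‖ * (2 * qaTailConst k / (γ * (1 + γ * T) ^ (k + 1))) := by
  have hint := integrable_qaWeight_smul_heisenbergEvolution hH hγ.ne' A
  have hint' := integrable_qaWeight_smul_heisenbergEvolution hH' hγ.ne' A
  have hW := (integrable_qaWeight hγ.ne').abs
  have hmeas : MeasurableSet {t : ℝ | T < |t|} := measurableSet_lt measurable_const continuous_abs.measurable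
  set D : ℝ → Matrix n n ℂ := fun t => heisenbergEvolution H t A - heisenbergEvolution H' t A with hD
  have hD2 : ∀ t, ‖D t‖ ≤ 2 * ‖A‖ := fun t => by
    calc ‖D t‖ ≤ ‖heisenbergEvolution H t A‖ + ‖heisenbergEvolution H' t A‖ := norm_sub_le _ _
      _ = 2 * ‖A‖ := by rw [norm_heisenbergEvolution_holds hH, norm_heisenbergEvolution_holds hH']; ring
  -- pointwise bound on the integrand
  have hpt : ∀ t : ℝ, ‖(qaWeight γ t : ℂ) • heisenbergEvolution H t A - (qaWeight γ t : ℂ) • heisenbergEvolution H' t A‖ ≤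
      ε * |qaWeight γ t| + 2 * ‖A‖ * Set.indicator {t : ℝ | T < |t|} (fun t => |qaWeight γ t|) t := by
    intro t
    rw [← smul_sub, norm_smul, Complex.norm_real, Real.norm_eq_abs]
    change |qaWeight γ t| * ‖D t‖ ≤ _
    by_cases ht : |t| ≤ T
    · have h1 : |qaWeight γ t| * ‖D t‖ ≤ ε * |qaWeight γ t| := by
        rw [mul_comm]; exact mul_le_mul_of_nonneg_right (hε t ht) (abs_nonneg _)
      have h2 : 0 ≤ 2 * ‖A‖ * Set.indicator {t : ℝ | T < |t|} (fun t => |qaWeight γ t|) t :=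
        mul_nonneg (by positivity) (Set.indicator_nonneg (fun _ _ => abs_nonneg _) _)
      linarith
    · rw [Set.indicator_of_mem (show t ∈ {t : ℝ | T < |t|} from not_le.1 ht)]
      have h1 : |qaWeight γ t| * ‖D t‖ ≤ 2 * ‖A‖ * |qaWeight γ t| := by
        rw [mul_comm]; exact mul_le_mul_of_nonneg_right (hD2 t) (abs_nonneg _)
      have h2 : 0 ≤ ε * |qaWeight γ t| := mul_nonneg hε0 (abs_nonneg _)
      linarith
  have hrhs : Integrable fun t : ℝ =>
      ε * |qaWeight γ t| + 2 * ‖A‖ * Set.indicator {t : ℝ | T < |t|} (fun t => |qaWeight γ t|) t :=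
    (hW.const_mul ε).add ((hW.indicator hmeas).const_mul _)
  unfold qaGenerator
  rw [← integral_sub hint hint']
  calc ‖∫ t, ((qaWeight γ t : ℂ) • heisenbergEvolution H t A - (qaWeight γ t : ℂ) • heisenbergEvolution H' t A)‖
      ≤ ∫ t, ‖(qaWeight γ t : ℂ) • heisenbergEvolution H t A - (qaWeight γ t : ℂ) • heisenbergEvolution H' t A‖ :=
        norm_integral_le_integral_norm _
    _ ≤ ∫ t, (ε * |qaWeight γ t| + 2 * ‖A‖ * Set.indicator {t : ℝ | T < |t|} (fun t => |qaWeight γ t|) t) :=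
        integral_mono (hint.sub hint').norm hrhs hpt
    _ = ε * (qaWeightL1 / γ) + 2 * ‖A‖ * ∫ t in {t : ℝ | T < |t|}, |qaWeight γ t| := by
        rw [integral_add (hW.const_mul ε) ((hW.indicator hmeas).const_mul _), integral_const_mul,
          integral_const_mul, integral_indicator hmeas, integral_abs_qaWeight hγ]
    _ ≤ ε * (qaWeightL1 / γ) + 2 * ‖A‖ * (2 * qaTailConst k / (γ * (1 + γ * T) ^ (k + 1))) := by
        gcongr
        exact integral_abs_qaWeight_tail_le k hγ hT

/-- **Locality of the generator from a commutator (Lieb–Robinson-type) bound**: if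
`‖[τ_u^H(H - H'), A]‖ ≤ η` for all `|u| ≤ T`, then
`‖𝓘_γ^H(A) - 𝓘_γ^{H'}(A)‖ ≤ ηT ‖W₁‖₁/γ + 4‖A‖ C_k γ⁻¹ (1+γT)^{-(k+1)}`. [folklore] -/
theorem norm_qaGenerator_sub_qaGenerator_le_of_commutator {H H' : Matrix n n ℂ} (hH : H.IsHermitian)
    (hH' : H'.IsHermitian) {γ : ℝ} (hγ : 0 < γ) (A : Matrix n n ℂ) {T η : ℝ} (hT : 0 ≤ T)
    (hη0 : 0 ≤ η)
    (hη : ∀ u : ℝ, |u| ≤ T →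
      ‖heisenbergEvolution H u (H - H') * A - A * heisenbergEvolution H u (H - H')‖ ≤ η)
    (k : ℕ) :
    ‖qaGenerator γ H A - qaGenerator γ H' A‖ ≤
      η * T * (qaWeightL1 / γ) + 2 * ‖A‖ * (2 * qaTailConst k / (γ * (1 + γ * T) ^ (k + 1))) := by
  refine norm_qaGenerator_sub_qaGenerator_le hH hH' hγ A hT (mul_nonneg hη0 hT) (fun t ht => ?_) k
  calc ‖heisenbergEvolution H t A - heisenbergEvolution H' t A‖ ≤ η * |t| :=
        norm_heisenbergEvolution_sub_heisenbergEvolution_le_of_le hH hH' A fun u hu => hη u (hu.trans ht)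
    _ ≤ η * T := mul_le_mul_of_nonneg_left ht hη0

end Generator

end Literature.MathematicalPhysics.QuantumLattice

end
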